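import Summits.CriticalPhenomena.PercolationContinuityZ3.Theorems.SahiMasterFamilyPrivateGluing
import Summits.CriticalPhenomena.PercolationContinuityZ3.Theorems.SahiMasterFamilyMinors

/-!
# The zero-flag class is minor-closed; zero flags are affine in a private coordinate

Unit `prim-master-conj` (crux anchor stmt-CriticalPhenomena-4575), gen 7.
* **`suppZeroFlag_secAt_family`** (every order): if `U ∈ Z_k` then both `e`-minors `(U_j^{e←b})_j` lie in `Z_k` — sections commute with
  deleting a slot and with the shrinks `U_l ↦ U_l ∩ U_i` (`secAt_inter`), so the recursive certificate of `U` is a certificate for its minors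
  (order 2: sections keep determining sets, `determinedBy_secAt`).  Hence `Z_k` is a MINOR-CLOSED class of families of increasing events, and
  the terminal families of `SahiMasterFamilyTerminalAll` are its excluded minors with no zero-flag sub-family.
* **`suppZeroFlag_iff_minors_of_private`**: for a coordinate `e` private to one slot, `U ∈ Z_k ⟺ both e-minors ∈ Z_k` (⇐ is private gluing,
  `suppZeroFlag_of_minors_of_private`) — the combinatorial shadow of `E_k(μ_p; U) = (1−p_e) E_k(U^{e←0}) + p_e E_k(U^{e←1})`.
Axioms standard. [this work]
-/

noncomputable section

open scoped Classical

namespace Summit.CriticalPhenomena.PercolationContinuityZ3.Theorems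

open Finset Function
open Literature.Probability.LatticeModels.Kahn2022 (Affects)
open Literature.Probability.Percolation (DeterminedBy)

variable {ι : Type} [Fintype ι]

omit [Fintype ι] in
/-- Sections commute with deleting a slot and shrinking a member (bookkeeping). [this work] -/
theorem secAt_update_inter (e : ι) (b : Bool) {m : ℕ} (V : Fin m → Set (Set ι)) (l : Fin m) (W : Set (Set ι)) :
    (fun j => secAt e b (update V l (V l ∩ W) j)) = update (fun j => secAt e b (V j)) l (secAt e b (V l) ∩ secAt e b W) := by
  funext j
  by_cases hj : j = l
  · subst hj; rw [update_self, update_self, secAt_inter]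
  · rw [update_of_ne hj, update_of_ne hj]

omit [Fintype ι] in
/-- **`Z_k` is minor-closed**: both `e`-sections of a zero flag are zero flags, every order. [this work] -/
theorem suppZeroFlag_secAt_family (e : ι) (b : Bool) :
    ∀ (k : ℕ) (U : Fin k → Set (Set ι)), SuppZeroFlag k U → SuppZeroFlag k (fun j => secAt e b (U j))
  | 0, _, _ => trivial
  | 1, U, h => by
    change U 0 = ∅ at h
    change secAt e b (U 0) = ∅
    rw [h]; ext ω; simp [mem_secAt]
  | 2, U, h => by
    obtain ⟨S, T, hST, hS, hT⟩ := h
    exact ⟨S.erase e, T.erase e, Finset.disjoint_of_subset_left (erase_subset _ _)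
      (Finset.disjoint_of_subset_right (erase_subset _ _) hST), determinedBy_secAt e b hS, determinedBy_secAt e b hT⟩
  | k + 3, U, h => by
    obtain ⟨i, hi, hl⟩ := h
    refine ⟨i, suppZeroFlag_secAt_family e b (k + 2) _ hi, fun l => ?_⟩
    have := suppZeroFlag_secAt_family e b (k + 2) _ (hl l)
    rwa [secAt_update_inter] at this

/-- **Zero flags are affine in a private coordinate**: if `e` acts on no member of `U` off the slot `c`, then `U ∈ Z_{k+2}` iff both
`e`-minors of `U` are in `Z_{k+2}`. [this work] -/
theorem suppZeroFlag_iff_minors_of_private {k : ℕ} (U : Fin (k + 2) → Set (Set ι)) (hU : ∀ j, IsUpperSet (U j)) (c : Fin (k + 2))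
    (e : ι) (heU : ∀ j, j ≠ c → ¬ Affects (U j) e) :
    SuppZeroFlag (k + 2) U ↔
      SuppZeroFlag (k + 2) (fun j => secAt e false (U j)) ∧ SuppZeroFlag (k + 2) (fun j => secAt e true (U j)) :=
  ⟨fun h => ⟨suppZeroFlag_secAt_family e false (k + 2) U h, suppZeroFlag_secAt_family e true (k + 2) U h⟩,
    fun h => suppZeroFlag_of_minors_of_private U hU c e heU h.1 h.2⟩

end Summit.CriticalPhenomena.PercolationContinuityZ3.Theorems
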